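import Summits.QuantumFields.YangMills.Theorems.BalabanUVNodesN11SupplyChainFirstStepSupplier

/-!
# DAG node N11 — THE FIRST-STEP SUPPLIER's CHAIN CARRIES FIRST-STEP TERMS ONLY: along the chain of `firstStepSupplier θ p u E₁` every term value at the levels `2 ≤ j ≤ k`
# VANISHES, so def-T's operand rows along that chain — hence the no-expansion obligation, N11's token and THEOREM 1 OF [III] in a run with no 𝐓-present expansion child
# above the first level — read the term rows of `u` AT LEVEL `1` ONLY (p607400 asked them at every level `j ≥ 1`)

HEADER — WORK-UNIT METADATA.  Cell `pub-ymgap`, YM-PLAN Track A (HUMAN RULING D-0062 ∕ D-0149 width push), seat `pub-ymgap-dag-n08-w2` (g6; WIDTH SEAT 2∕4 on N08 [B10],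
re-pointed by the dag-lead desk to N11's §3-supply residue, DEDUP-354∕355), route `BalabanUVNodes` rev 25 (v1.7 `CoPH` key), item K1⁷ `StabilityBAtRecordR13SepCoPH` =
stmt-QuantumFields-20542; PROOF lane (`--kind proof --supports 20542 --as helper`; theorems only, 0 `def`), count-neutral.  [III] = [Balaban1988Convergent], [I] = [Balaban1987RG1],
[IV] = [Balaban1989LargeFieldI].  Over this seat's `…N11SupplyChainFirstStepSupplier` (p607400) and `…N11SupplyChainFirstLink` (p597418: `firstStepSupplier`), dag-n11-e's
`…Sect3SupplyChainZero` (p597757: `spliceTermsB_zero_agree_pos` — one splice with a zero response keeps vanishing levels vanishing) and `…Sect3SupplyChainDefs ∕ …ObligationsDefs ∕ …Node`,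
dag-n11-w3's `…Sect3SupplyChainTermRows` (`TermRowsAt`, `termRowsAt_spliceTermsB`, `termRowsAt_zero`, `operandRowsAt_of_termRows`), dag-n08-w2 g0's `sect2Operand_congr_of_agree_pos` (p586913).

WHY THIS FILE.  p607400 §1 read def-T's operand rows along the first-step supplier's chain from the term rows of `u s` at EVERY level `j ≥ 1` (dag-n11-w3's generic `SupplierTermRows`).
But the first-step supplier responds with `u` at level `0` and with ZERO above, and each splice keeps at the levels `≤ k` what the chain already carries (cutting or re-supplying
only `𝐁^{(k)}`) and takes the levels `> k` from the response: so along ITS chain the level-`k` witness carries `u`'s level-`1` terms (its `𝐑^{(1)} ∕ 𝐁^{(1)}` possibly cut at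
non-present children, by the splice's own rules) and NOTHING at the levels `2 … k`.  (2.23) at index `k` reads the levels `1 … k`; hence everything the chain road asks of the
first-step terms is asked AT LEVEL `1`:
§1 ★ `chainWitness_firstStepSupplier_agree_above_one` — along the first-step supplier's chain every term value at the levels `2 ≤ j ≤ k` is ZERO (induction over the splice by
   dag-n11-e's `spliceTermsB_zero_agree_pos`; the analogue of their ★ for the zero supplier, one level up); `sect2Operand_chainWitness_firstStepSupplier` — the operand of the level-`k`
   chain witness IS the operand of its level-`1` truncation (dag-n08-w2 g0's congruence).
§2 ★ `termRowsAt_chainWitness_firstStepSupplier_of_termRows_one` — from the term rows of `u s₁` AT LEVEL `1` (every `s₁`), every level `1 ≤ j ≤ k` of the level-`k` chain witness has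
   the rows (induction by dag-n11-w3's `termRowsAt_spliceTermsB`: the response rows needed are `u`'s at `j = 1` when `k = 0` and the zero rows otherwise); ★★
   `operandRowsAlongChain_firstStepSupplier_of_termRows_one` — def-T's operand rows along the chain from `u`'s LEVEL-`1` rows only.  NO absence hypothesis.
§3 p607400's dischargers and headline faces RE-ISSUED WITH LEVEL-`1` ROWS: `noExpansionObligation_firstStepSupplier_of_residualRows₁ ∕ _of_gaussCert₁` (no absence hypothesis) ·
   ★★ `supplyChainAt_of_firstStepSupplier_of_residualRows₁` · ★★ `sLaw₁₃CoPH_all_of_firstStepSupplier_of_residualRows₁ ∕ _of_gaussCert₁` (generic `θ`, live-selector line) · ★★★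
   `sLaw₁₃CoPH_all_gaussCertH_theta13LiveOfRecord_of_firstStepSupplier₁` (at any Gaussian-class H-extension of the witness of record: from `hrec`, first-step data and `u`'s
   level-`1` rows — nothing else).

HONEST FRAMING.  Count-neutral KERNEL BOOKKEEPING (two inductions over the splice + compositions); the absence-above-the-first-level world is a DEGENERATE data regime; the
first-step clauses at the 𝐓-present pairs ARE [I] Thm 1 + [II] at def-T's level-1 objects — NOT proved here for any `θ`; `TermRowsAt θ p (u s₁) 1` is a DISPLAYED measurability ∕
bound hypothesis on the first-step terms (def-T's `Sect2.TermValues` carries no such law); nothing of Bałaban asserted; N11 NOT discharged; N08 untouched; K1⁷ NOT closed; counts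
unmoved (typed 28∕28 · discharged 5∕27).  One finite `𝕋⁴_{L^K}` programme at fixed `ε = L^{−K}`; R4 closes only the conditional finite-𝕋⁴ rung `BalabanLadder.UV` — NOT ℝ⁴,
NOT OS, NOT a mass gap, NOT Clay.  No `sorry`, no `axiom`, no `def`, no `instance`, no `notation`.
Sources (SHAPE only): [III] Theorem p.245, Thm 1 p.262, §2 p.262, §3 p.279, (3.1) p.264, (3.16)–(3.21) pp.268–269, (3.23)–(3.25) p.270, (2.18) p.257, (2.20)–(2.27) pp.258–259,
(2.30)–(2.31) p.260, (2.40)–(2.41) p.261; [I] Thm 1 p.259; [IV] (0.2)–(0.4) p.176, p.177 (i)–(ii).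
-/

noncomputable section

open MeasureTheory
open scoped BigOperators ENNReal NNReal Matrix.Norms.L2Operator

namespace Summit.QuantumFields.YangMills.Theorems.BalabanUVNodesN11SupplyChainFirstStepSupplierTerms

open Literature.MathematicalPhysics.QuantumFieldTheory.Balaban1983to89 T4Continuum Node00 Node00.Tk
open B10Eq42TorusConstraint (bondsIn)
open Literature.MathematicalPhysics.QuantumFieldTheory.Balaban1983to89.B16RLeafRecord13AtLive (E0_nonneg_theta13LiveOfFamily)
open BalabanUVNodesN11HistoryPinnedResidualDefs (ZhPinOfRecord₁₃)
open BalabanUVNodesN11FluctTruncationDefs (IsFluctLocal)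
open BalabanUVNodesN11Sect3SupplySpliceDefs (graftAbove graftAbove_E_of_le graftAbove_R_of_le graftAbove_B_of_le graftAbove_E_of_lt graftAbove_R_of_lt graftAbove_B_of_lt)
open BalabanUVNodesN11Sect3SupplyChainDefs
open BalabanUVNodesN11Sect3SupplyChainObligationsDefs
open BalabanUVNodesN11Sect3SupplyChainNode (sLaw₁₃CoPH_all_of_obligations_of_rows sLaw₁₃CoPH_all_of_obligations_of_gaussCert
  sLaw₁₃CoPH_all_gaussCertH_theta13LiveOfRecord_of_obligations_of_operandRows)
open BalabanUVNodesN11Sect3SupplyChainZero (spliceTermsB_zero_agree_pos)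
open BalabanUVNodesN11Sect3SupplyChainTermRows (TermRowsAt termRowsAt_zero termRowsAt_spliceTermsB operandRowsAt_of_termRows)
open BalabanUVNodesN11FirstStepSupply (sect2Operand_congr_of_agree_pos)
open BalabanUVNodesN11SupplyChainFirstLink (FirstLinkObligations firstStepSupplier)
open BalabanUVNodesN11SupplyChainFirstStepSupplier

variable {F : T4Family} {N : ℕ} [NeZero N]

/-! ## §1. Along the first-step supplier's chain the levels `2 … k` are empty -/

section Vanish

variable (θ : Stage13HParams F N) (p : B12.RunParams)
variable (u : SeqOfRecord F θ.ν θ.τ9.M (gOfRecord₁₃ F N θ.toStage13Params p) p.K 1 → Sect2.TermValues (F.P p.K) (MatA N) (FluctV N) θ.τ9.M)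
  (E₁ : SeqOfRecord F θ.ν θ.τ9.M (gOfRecord₁₃ F N θ.toStage13Params p) p.K 1 → ℝ)

/-- **★ ALONG THE FIRST-STEP SUPPLIER's CHAIN EVERY TERM VALUE AT THE LEVELS `2 ≤ j ≤ k` IS ZERO** (`𝐄`, `𝐑` and `𝐁`, at every history): the chain's level-`(k+1)` witness for
`k ≥ 1` is the splice of the level-`k` witness with the ZERO response (p607400 §1, `rfl`), and one splice with a zero response keeps the vanishing levels `≤ k` vanishing and
makes every level `> k` vanish (dag-n11-e's `spliceTermsB_zero_agree_pos`) — induction on `k` from the vacuous `k ≤ 1`.  The level-`1` terms (from `u`, through the first splice's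
own rules) and the opaque level-`0` terms of def-T's base witness are not touched by the claim. [cite: Balaban1988Convergent, (2.25) p.259, (2.30) p.260, (2.40) p.261, (3.24)–(3.25) p.270, §3 p.279 (bookkeeping)] -/
theorem chainWitness_firstStepSupplier_agree_above_one :
    ∀ (k : ℕ) (s : SeqOfRecord F θ.ν θ.τ9.M (gOfRecord₁₃ F N θ.toStage13Params p) p.K k) (j : ℕ), 2 ≤ j → j ≤ k →
      (∀ (X : (Sect2.domSys (F.P p.K) θ.τ9.M j).Dom) (z : Site (F.P p.K) j) (gc : ℝ) (φ : Sect2.CPair (F.P p.K) (MatA N)),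
          ((chainWitness θ p (firstStepSupplier θ p u E₁) k).1 s).E j X z gc φ = 0) ∧
      (∀ (X : (Sect2.domSys (F.P p.K) θ.τ9.M j).Dom) (φ : Sect2.CPair (F.P p.K) (MatA N)), ((chainWitness θ p (firstStepSupplier θ p u E₁) k).1 s).R j X φ = 0) ∧
      (∀ (X : (Sect2.domSys (F.P p.K) θ.τ9.M j).Dom) (φ : Sect2.CPair (F.P p.K) (MatA N)) (a : SFluct (F.P p.K) (FluctV N)),
          ((chainWitness θ p (firstStepSupplier θ p u E₁) k).1 s).B j X φ a = 0) := by
  intro k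
  induction k with
  | zero => intro s j h2 h0; omega
  | succ k ih =>
    intro s j h2 hjk
    cases k with
    | zero => omega
    | succ k =>
      -- the response at the level `k+1 ≥ 1` is zero: one splice with a zero response
      exact spliceTermsB_zero_agree_pos (θ := θ) (p := p) (k + 1) (chainWitness θ p (firstStepSupplier θ p u E₁) (k + 1)).1 s j
        fun hj => ih s.init j h2 hj

/-- **THE OPERAND OF THE FIRST-STEP SUPPLIER's LEVEL-`k` CHAIN WITNESS IS THE OPERAND OF ITS LEVEL-`1` TRUNCATION** `graftAbove 1 t 0` (levels `≤ 1` kept, zero above): (2.23) at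
index `k` reads the levels `1 … k` (dag-n08-w2 g0's `sect2Operand_congr_of_agree_pos`), where the two agree by §1 ★. [cite: Balaban1988Convergent, (2.18) p.257, (2.23)–(2.25) pp.258–259, (2.30) p.260, (2.40) p.261] -/
theorem sect2Operand_chainWitness_firstStepSupplier (k : ℕ) (s : SeqOfRecord F θ.ν θ.τ9.M (gOfRecord₁₃ F N θ.toStage13Params p) p.K k)
    (S : Sect2.Setting (MatA N) (SU N)) (Rz : Sect2.Residual (F.P p.K) (MatA N)) (E₀ : ℝ) (U : BgMap F N p.K) :
    sect2Operand F N (FluctV N) p.K S Rz s ((chainWitness θ p (firstStepSupplier θ p u E₁) k).1 s) E₀ U =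
      sect2Operand F N (FluctV N) p.K S Rz s (graftAbove 1 ((chainWitness θ p (firstStepSupplier θ p u E₁) k).1 s) Sect2.TermValues.zero) E₀ U := by
  refine sect2Operand_congr_of_agree_pos S Rz s (fun j _ hj X z gc φ => ?_) (fun j _ hj X φ => ?_) (fun j _ hj X φ a => ?_) E₀ U
  · by_cases hj1 : j ≤ 1
    · rw [graftAbove_E_of_le _ _ hj1]
    · rw [graftAbove_E_of_lt _ _ (not_le.mp hj1)]
      exact (chainWitness_firstStepSupplier_agree_above_one θ p u E₁ k s j (by omega) hj).1 X z gc φ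
  · by_cases hj1 : j ≤ 1
    · rw [graftAbove_R_of_le _ _ hj1]
    · rw [graftAbove_R_of_lt _ _ (not_le.mp hj1)]
      exact (chainWitness_firstStepSupplier_agree_above_one θ p u E₁ k s j (by omega) hj).2.1 X φ
  · by_cases hj1 : j ≤ 1
    · rw [graftAbove_B_of_le _ _ hj1]
    · rw [graftAbove_B_of_lt _ _ (not_le.mp hj1)]
      exact (chainWitness_firstStepSupplier_agree_above_one θ p u E₁ k s j (by omega) hj).2.2 X φ a

end Vanish

/-! ## §2. def-T's operand rows along the first-step supplier's chain from the term rows of `u` at level `1` only -/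

section RowsOne

variable (θ : Stage13HParams F N) (p : B12.RunParams)
variable (u : SeqOfRecord F θ.ν θ.τ9.M (gOfRecord₁₃ F N θ.toStage13Params p) p.K 1 → Sect2.TermValues (F.P p.K) (MatA N) (FluctV N) θ.τ9.M)
  (E₁ : SeqOfRecord F θ.ν θ.τ9.M (gOfRecord₁₃ F N θ.toStage13Params p) p.K 1 → ℝ)

/-- **★ FROM THE TERM ROWS OF `u s₁` AT LEVEL `1` (every `s₁`), EVERY LEVEL `1 ≤ j ≤ k` OF THE FIRST-STEP SUPPLIER's LEVEL-`k` CHAIN WITNESS HAS THE ROWS** — induction on `k` by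
dag-n11-w3's `termRowsAt_spliceTermsB` (the splice SELECTS values pointwise: at `j ≤ k` from the old witness — inductive hypothesis —, at `k ≤ j` from the response: `u`'s level-`1`
rows when `k = 0` (then `j = 1`), the zero rows `termRowsAt_zero` when `k ≥ 1`); base vacuous. [cite: Balaban1988Convergent, (2.23)–(2.27) pp.258–259, (2.30)–(2.31) p.260, (2.40)–(2.41) p.261, (3.24)–(3.25) p.270, §3 p.279 (bookkeeping)] -/
theorem termRowsAt_chainWitness_firstStepSupplier_of_termRows_one
    (hrows₁ : ∀ s₁ : SeqOfRecord F θ.ν θ.τ9.M (gOfRecord₁₃ F N θ.toStage13Params p) p.K 1, TermRowsAt θ p (u s₁) 1) :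
    ∀ (k : ℕ) (s : SeqOfRecord F θ.ν θ.τ9.M (gOfRecord₁₃ F N θ.toStage13Params p) p.K k) (j : ℕ), 1 ≤ j → j ≤ k →
      TermRowsAt θ p ((chainWitness θ p (firstStepSupplier θ p u E₁) k).1 s) j := by
  intro k
  induction k with
  | zero => intro s j h1 h0; omega
  | succ k ih =>
    intro s j h1 hjk
    refine termRowsAt_spliceTermsB k (chainWitness θ p (firstStepSupplier θ p u E₁) k).1 _ s j (fun hj => ih s.init j h1 hj) fun hkj => ?_
    cases k with
    | zero =>
      obtain rfl : j = 1 := le_antisymm hjk h1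
      exact hrows₁ s
    | succ k => exact termRowsAt_zero j

/-- **★★ def-T's OPERAND ROWS ALONG THE FIRST-STEP SUPPLIER's CHAIN FROM THE TERM ROWS OF `u` AT LEVEL `1` ONLY** (§2 ★ + dag-n11-w3's ★★ `operandRowsAt_of_termRows` at `init s′`;
`k < K`, the inductive form and the presence of the parent are not read).  NO absence hypothesis.  Sharpens p607400's `operandRowsAlongChain_firstStepSupplier` (rows at every `j ≥ 1`).
[cite: Balaban1988Convergent, (2.20)–(2.23) p.258, (3.16)–(3.21) pp.268–269, (3.24) p.270] -/
theorem operandRowsAlongChain_firstStepSupplier_of_termRows_one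
    (hrows₁ : ∀ s₁ : SeqOfRecord F θ.ν θ.τ9.M (gOfRecord₁₃ F N θ.toStage13Params p) p.K 1, TermRowsAt θ p (u s₁) 1) :
    OperandRowsAlongChain θ p (firstStepSupplier θ p u E₁) := fun k _ _ s _ _ =>
  operandRowsAt_of_termRows θ p k s _ _ fun j h1 hj => termRowsAt_chainWitness_firstStepSupplier_of_termRows_one θ p u E₁ hrows₁ k s.init j h1 hj

end RowsOne

/-! ## §3. p607400's dischargers and headline faces with level-`1` rows -/

section Faces

variable {θ : Stage13HParams F N} {p : B12.RunParams}
variable (u : SeqOfRecord F θ.ν θ.τ9.M (gOfRecord₁₃ F N θ.toStage13Params p) p.K 1 → Sect2.TermValues (F.P p.K) (MatA N) (FluctV N) θ.τ9.M)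
  (E₁ : SeqOfRecord F θ.ν θ.τ9.M (gOfRecord₁₃ F N θ.toStage13Params p) p.K 1 → ℝ)

/-- **THE NO-EXPANSION OBLIGATION OF THE FIRST-STEP SUPPLIER's CHAIN FROM THE ROWS, LEVEL-`1` TERM ROWS ONLY** (dag-n11-d's road via dag-n11-e's
`noExpansionObligation_of_residualRows_of_operandRows`; core provisos, `ZhUnity`, `1 ≤ M`, `1`-locality of `u`, `ResidualRows θ p`).  NO absence hypothesis.
[cite: Balaban1988Convergent, Theorem p.245, (3.24)–(3.25) p.270, (3.1) p.264, (3.16)–(3.21) pp.268–269; Balaban1989LargeFieldI, (0.2)–(0.3) p.176] -/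
theorem noExpansionObligation_firstStepSupplier_of_residualRows₁ (h : θ.Provisos₁₃CoPH F N) (hU : θ.ZhUnity F N) (hM : 1 ≤ θ.τ9.M)
    (hloc : ∀ s : SeqOfRecord F θ.ν θ.τ9.M (gOfRecord₁₃ F N θ.toStage13Params p) p.K 1, IsFluctLocal 1 (u s)) (hres : ResidualRows θ p)
    (hrows₁ : ∀ s₁ : SeqOfRecord F θ.ν θ.τ9.M (gOfRecord₁₃ F N θ.toStage13Params p) p.K 1, TermRowsAt θ p (u s₁) 1) :
    NoExpansionObligation θ p (firstStepSupplier θ p u E₁) :=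
  noExpansionObligation_of_residualRows_of_operandRows h hU hM _ ((loc_firstStepSupplier_iff θ p u E₁).mpr hloc) hres
    (operandRowsAlongChain_firstStepSupplier_of_termRows_one θ p u E₁ hrows₁)

/-- **THE NO-EXPANSION OBLIGATION OF THE FIRST-STEP SUPPLIER's CHAIN AT ANY `θ` OF THE GAUSSIAN-CERTIFICATE CLASS FROM `u`'s LEVEL-`1` TERM ROWS ALONE** (dag-n11-w1's road via
dag-n11-e ★★).  NO absence hypothesis, no `ZhUnity`, no residual row. [cite: Balaban1988Convergent, Theorem p.245, Thm 1 p.262, (3.23)–(3.25) p.270, (2.23) p.258] -/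
theorem noExpansionObligation_firstStepSupplier_of_gaussCert₁
    (hζ : ∀ (p : B12.RunParams) (n : ℕ) (Ω Λ : ℕ → Set (Site (F.P p.K) 0)), (θ.Zh p n Ω Λ).ζ0 = (ZhPinOfRecord₁₃ θ.toStage13Params p Ω Λ).ζ0)
    (hq : ∀ (p : B12.RunParams) (n : ℕ) (Ω Λ : ℕ → Set (Site (F.P p.K) 0)) (j : ℕ) (Λ' : Set (Site (F.P p.K) 0)) (ω : MultiCfg (F.P p.K) (SU N) (FluctV N)),
      (θ.Zh p n Ω Λ).quad j Λ' ω = ∑ b ∈ (Set.toFinite (bondsIn j (Λ'ᶜ ∩ Ω (j + 1)))).toFinset, ‖(ω j).2 b‖ ^ 2)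
    (h : θ.Provisos₁₃CoPH F N) (hM : 1 ≤ θ.τ9.M)
    (hloc : ∀ s : SeqOfRecord F θ.ν θ.τ9.M (gOfRecord₁₃ F N θ.toStage13Params p) p.K 1, IsFluctLocal 1 (u s))
    (hrows₁ : ∀ s₁ : SeqOfRecord F θ.ν θ.τ9.M (gOfRecord₁₃ F N θ.toStage13Params p) p.K 1, TermRowsAt θ p (u s₁) 1) :
    NoExpansionObligation θ p (firstStepSupplier θ p u E₁) :=
  noExpansionObligation_of_gaussCert_of_operandRows hζ hq h hM _ ((loc_firstStepSupplier_iff θ p u E₁).mpr hloc)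
    (operandRowsAlongChain_firstStepSupplier_of_termRows_one θ p u E₁ hrows₁)

/-- **★★ N11's TOKEN IN A RUN WITH NO 𝐓-PRESENT EXPANSION CHILD ABOVE THE FIRST LEVEL FROM FIRST-STEP DATA + THE ROWS, LEVEL-`1` TERM ROWS ONLY** (generic `θ`: core provisos,
`ZhUnity`, `1 ≤ M`, `0 ≤ E₀`; `ResidualRows θ p`). [cite: Balaban1988Convergent, Thm 1 p.262, Theorem p.245, §3 p.279, (3.24)–(3.25) p.270; Balaban1987RG1, Thm 1 p.259; Balaban1989LargeFieldI, (0.2)–(0.3) p.176] -/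
theorem supplyChainAt_of_firstStepSupplier_of_residualRows₁ (h : θ.Provisos₁₃CoPH F N) (hU : θ.ZhUnity F N) (hM : 1 ≤ θ.τ9.M) (hE₀ : 0 ≤ θ.s2.lf.E₀)
    (habs : ∀ k, 1 ≤ k → k < p.K → ∀ s : SeqOfRecord F θ.ν θ.τ9.M (gOfRecord₁₃ F N θ.toStage13Params p) p.K (k + 1), s.Ω (k + 1) ≠ ∅ →
      slotsTOfRecord F N θ.ν θ.τ9 (EOfRecord₁₃ F N θ.toStage13Params) (wOfRecord₉ F N θ.toStage9Params) θ.ppSel p (gOfRecord₁₃ F N θ.toStage13Params p) (k + 1) s = 0)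
    (hloc : ∀ s : SeqOfRecord F θ.ν θ.τ9.M (gOfRecord₁₃ F N θ.toStage13Params p) p.K 1, IsFluctLocal 1 (u s))
    (hlink : 0 < p.K → FirstLinkObligations θ p (firstStepSupplier θ p u E₁)) (hres : ResidualRows θ p)
    (hrows₁ : ∀ s₁ : SeqOfRecord F θ.ν θ.τ9.M (gOfRecord₁₃ F N θ.toStage13Params p) p.K 1, TermRowsAt θ p (u s₁) 1) : SupplyChainAt θ p :=
  supplyChainAt_of_firstStepSupplier u E₁ hE₀ habs hloc hlink (noExpansionObligation_firstStepSupplier_of_residualRows₁ u E₁ h hU hM hloc hres hrows₁)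

/-- **★★ THEOREM 1 OF [III] AT A GENERIC `θ`, ALL LEVELS, IN SUCH A RUN — FROM FIRST-STEP DATA, THE WITNESS-FREE RESIDUAL ROWS AND `u`'s LEVEL-`1` TERM ROWS** on the live-selector
line (core provisos, `ZhUnity`, selector clause, admissibility, `0 ≤ κ, E₀, B₀`, `1 ≤ M`). [cite: Balaban1988Convergent, Thm 1 p.262, Theorem p.245, Thm 2 p.263, §3 p.279, (3.24)–(3.25) p.270, (3.16)–(3.21) pp.268–269; Balaban1987RG1, Thm 1 p.259; Balaban1989LargeFieldI, (0.2)–(0.4) p.176, p.177 (i)–(ii)] -/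
theorem sLaw₁₃CoPH_all_of_firstStepSupplier_of_residualRows₁ (h : θ.Provisos₁₃CoPH F N) (hU : θ.ZhUnity F N)
    (hsel : θ.ppSel = ppSelLiveOfRecord F N θ.ν θ.τ9 (EOfRecord₁₃ F N θ.toStage13Params) (wOfRecord₉ F N θ.toStage9Params))
    (hθ : θ.Admissible F N) (hκ : 0 ≤ θ.s2.lf.κ) (hE₀ : 0 ≤ θ.s2.lf.E₀) (hB₀ : 0 ≤ θ.s2.lf.B₀) (hM : 1 ≤ θ.τ9.M)
    (habs : ∀ k, 1 ≤ k → k < p.K → ∀ s : SeqOfRecord F θ.ν θ.τ9.M (gOfRecord₁₃ F N θ.toStage13Params p) p.K (k + 1), s.Ω (k + 1) ≠ ∅ →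
      slotsTOfRecord F N θ.ν θ.τ9 (EOfRecord₁₃ F N θ.toStage13Params) (wOfRecord₉ F N θ.toStage9Params) θ.ppSel p (gOfRecord₁₃ F N θ.toStage13Params p) (k + 1) s = 0)
    (hloc : ∀ s : SeqOfRecord F θ.ν θ.τ9.M (gOfRecord₁₃ F N θ.toStage13Params p) p.K 1, IsFluctLocal 1 (u s))
    (hlink : 0 < p.K → FirstLinkObligations θ p (firstStepSupplier θ p u E₁)) (hres : ResidualRows θ p)
    (hrows₁ : ∀ s₁ : SeqOfRecord F θ.ν θ.τ9.M (gOfRecord₁₃ F N θ.toStage13Params p) p.K 1, TermRowsAt θ p (u s₁) 1) :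
    ∀ k, k ≤ p.K → SLaw₁₃CoPH F N θ p k :=
  sLaw₁₃CoPH_all_of_obligations_of_rows h hU hsel hθ hκ hE₀ hB₀ hM _ (supplierObligations_firstStepSupplier u E₁ hE₀ habs hloc hlink) hres
    (operandRowsAlongChain_firstStepSupplier_of_termRows_one θ p u E₁ hrows₁)

/-- **★★ THEOREM 1 OF [III] AT ANY `θ` OF THE GAUSSIAN-CERTIFICATE CLASS, ALL LEVELS, IN SUCH A RUN — FROM FIRST-STEP DATA AND `u`'s LEVEL-`1` TERM ROWS, NOTHING OF THE NO-EXPANSION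
LANE** (certificate `ζ0`, A-fibre Gaussian `quad`; live-selector line; core provisos). [cite: Balaban1988Convergent, Thm 1 p.262, Theorem p.245, §3 p.279, (3.23)–(3.25) p.270; Balaban1987RG1, Thm 1 p.259; Balaban1989LargeFieldI, (0.2)–(0.4) p.176, p.177 (i)–(ii)] -/
theorem sLaw₁₃CoPH_all_of_firstStepSupplier_of_gaussCert₁
    (hζ : ∀ (p : B12.RunParams) (n : ℕ) (Ω Λ : ℕ → Set (Site (F.P p.K) 0)), (θ.Zh p n Ω Λ).ζ0 = (ZhPinOfRecord₁₃ θ.toStage13Params p Ω Λ).ζ0)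
    (hq : ∀ (p : B12.RunParams) (n : ℕ) (Ω Λ : ℕ → Set (Site (F.P p.K) 0)) (j : ℕ) (Λ' : Set (Site (F.P p.K) 0)) (ω : MultiCfg (F.P p.K) (SU N) (FluctV N)),
      (θ.Zh p n Ω Λ).quad j Λ' ω = ∑ b ∈ (Set.toFinite (bondsIn j (Λ'ᶜ ∩ Ω (j + 1)))).toFinset, ‖(ω j).2 b‖ ^ 2)
    (h : θ.Provisos₁₃CoPH F N)
    (hsel : θ.ppSel = ppSelLiveOfRecord F N θ.ν θ.τ9 (EOfRecord₁₃ F N θ.toStage13Params) (wOfRecord₉ F N θ.toStage9Params))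
    (hθ : θ.Admissible F N) (hκ : 0 ≤ θ.s2.lf.κ) (hE₀ : 0 ≤ θ.s2.lf.E₀) (hB₀ : 0 ≤ θ.s2.lf.B₀) (hM : 1 ≤ θ.τ9.M)
    (habs : ∀ k, 1 ≤ k → k < p.K → ∀ s : SeqOfRecord F θ.ν θ.τ9.M (gOfRecord₁₃ F N θ.toStage13Params p) p.K (k + 1), s.Ω (k + 1) ≠ ∅ →
      slotsTOfRecord F N θ.ν θ.τ9 (EOfRecord₁₃ F N θ.toStage13Params) (wOfRecord₉ F N θ.toStage9Params) θ.ppSel p (gOfRecord₁₃ F N θ.toStage13Params p) (k + 1) s = 0)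
    (hloc : ∀ s : SeqOfRecord F θ.ν θ.τ9.M (gOfRecord₁₃ F N θ.toStage13Params p) p.K 1, IsFluctLocal 1 (u s))
    (hlink : 0 < p.K → FirstLinkObligations θ p (firstStepSupplier θ p u E₁))
    (hrows₁ : ∀ s₁ : SeqOfRecord F θ.ν θ.τ9.M (gOfRecord₁₃ F N θ.toStage13Params p) p.K 1, TermRowsAt θ p (u s₁) 1) :
    ∀ k, k ≤ p.K → SLaw₁₃CoPH F N θ p k :=
  sLaw₁₃CoPH_all_of_obligations_of_gaussCert hζ hq h hsel hθ hκ hE₀ hB₀ hM _ (supplierObligations_firstStepSupplier u E₁ hE₀ habs hloc hlink)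
    (operandRowsAlongChain_firstStepSupplier_of_termRows_one θ p u E₁ hrows₁)

end Faces

/-! ## §4. At the Gaussian-class H-extensions of the witness of record, level-`1` rows -/

section Record

variable (F N)
variable {Zr : (q : B12.RunParams) → TkResidualW F N (FluctV N) q.K}
  {Zh : (q : B12.RunParams) → ℕ → (ℕ → Set (Site (F.P q.K) 0)) → (ℕ → Set (Site (F.P q.K) 0)) → TkResidualW F N (FluctV N) q.K}
  {Phih : (q : B12.RunParams) → ℕ → (ℕ → Set (Site (F.P q.K) 0)) → (ℕ → Set (Site (F.P q.K) 0)) → (ℕ → Plaq (F.P q.K) 0 → ℝ)} (p : B12.RunParams)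

/-- **★★★ THEOREM 1 OF [III] AT ANY GAUSSIAN-CLASS H-EXTENSION OF THE WITNESS OF RECORD, ALL LEVELS, ALL HISTORIES, IN A RUN WITH NO 𝐓-PRESENT EXPANSION CHILD ABOVE THE FIRST
LEVEL — FROM `hrec`, FIRST-STEP DATA AND `u`'s LEVEL-`1` TERM ROWS, NOTHING ELSE** (p607400's ★★★ with the rows hypothesis cut to level `1`).
[cite: Balaban1988Convergent, Thm 1 p.262, Theorem p.245, p.244, §3 p.279, (3.23)–(3.25) p.270, (1.11) p.248, (3.16)–(3.22) pp.268–269; Balaban1987RG1, Thm 1 p.259; Balaban1989LargeFieldI, (0.3)–(0.4) p.176, p.177 (i)–(ii)] -/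
theorem sLaw₁₃CoPH_all_gaussCertH_theta13LiveOfRecord_of_firstStepSupplier₁
    (hζ : ∀ (p : B12.RunParams) (n : ℕ) (Ω Λ : ℕ → Set (Site (F.P p.K) 0)), (Zh p n Ω Λ).ζ0 = (ZhPinOfRecord₁₃ (theta13LiveOfRecord F N) p Ω Λ).ζ0)
    (hq : ∀ (p : B12.RunParams) (n : ℕ) (Ω Λ : ℕ → Set (Site (F.P p.K) 0)) (j : ℕ) (Λ' : Set (Site (F.P p.K) 0)) (ω : MultiCfg (F.P p.K) (SU N) (FluctV N)),
      (Zh p n Ω Λ).quad j Λ' ω = ∑ b ∈ (Set.toFinite (bondsIn j (Λ'ᶜ ∩ Ω (j + 1)))).toFinset, ‖(ω j).2 b‖ ^ 2)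
    (hrec : (⟨⟨theta13LiveOfRecord F N, Zr⟩, Zh, Phih⟩ : Stage13HParams F N).Provisos₁₃CoPH F N)
    (habs : ∀ k, 1 ≤ k → k < p.K → ∀ s : SeqOfRecord F (theta13LiveOfRecord F N).ν (theta13LiveOfRecord F N).τ9.M (gOfRecord₁₃ F N (theta13LiveOfRecord F N) p) p.K (k + 1),
      s.Ω (k + 1) ≠ ∅ → slotsTOfRecord F N (theta13LiveOfRecord F N).ν (theta13LiveOfRecord F N).τ9 (EOfRecord₁₃ F N (theta13LiveOfRecord F N))
        (wOfRecord₉ F N (theta13LiveOfRecord F N).toStage9Params) (theta13LiveOfRecord F N).ppSel p (gOfRecord₁₃ F N (theta13LiveOfRecord F N) p) (k + 1) s = 0)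
    (u : SeqOfRecord F (theta13LiveOfRecord F N).ν (theta13LiveOfRecord F N).τ9.M (gOfRecord₁₃ F N (theta13LiveOfRecord F N) p) p.K 1 →
      Sect2.TermValues (F.P p.K) (MatA N) (FluctV N) (theta13LiveOfRecord F N).τ9.M)
    (E₁ : SeqOfRecord F (theta13LiveOfRecord F N).ν (theta13LiveOfRecord F N).τ9.M (gOfRecord₁₃ F N (theta13LiveOfRecord F N) p) p.K 1 → ℝ)
    (hloc : ∀ s, IsFluctLocal 1 (u s))
    (hlink : 0 < p.K → FirstLinkObligations (⟨⟨theta13LiveOfRecord F N, Zr⟩, Zh, Phih⟩ : Stage13HParams F N) p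
      (firstStepSupplier (⟨⟨theta13LiveOfRecord F N, Zr⟩, Zh, Phih⟩ : Stage13HParams F N) p u E₁))
    (hrows₁ : ∀ s₁, TermRowsAt (⟨⟨theta13LiveOfRecord F N, Zr⟩, Zh, Phih⟩ : Stage13HParams F N) p (u s₁) 1) :
    ∀ k, k ≤ p.K → SLaw₁₃CoPH F N (⟨⟨theta13LiveOfRecord F N, Zr⟩, Zh, Phih⟩ : Stage13HParams F N) p k :=
  sLaw₁₃CoPH_all_gaussCertH_theta13LiveOfRecord_of_obligations_of_operandRows F N p hζ hq hrec _
    (supplierObligations_firstStepSupplier (θ := (⟨⟨theta13LiveOfRecord F N, Zr⟩, Zh, Phih⟩ : Stage13HParams F N)) u E₁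
      (E0_nonneg_theta13LiveOfFamily F N eps0OfRecord₁₃ (zeta316OfRecord F N (numerics7OfFamily eps0OfRecord₁₃) 1 1) (RzOfRecord F N) (ZtOfRecord F N)) habs hloc hlink)
    (operandRowsAlongChain_firstStepSupplier_of_termRows_one (⟨⟨theta13LiveOfRecord F N, Zr⟩, Zh, Phih⟩ : Stage13HParams F N) p u E₁ hrows₁)

end Record

end Summit.QuantumFields.YangMills.Theorems.BalabanUVNodesN11SupplyChainFirstStepSupplierTerms

end
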